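import Summits.QuantumFields.YangMills.Theorems.BalabanUVNodesN19MGFRoadLiveSelectorRStep
import Literature.MathematicalPhysics.QuantumFieldTheory.Balaban1983to89.Node00.Record12MeasurabilityAnySelector

/-!
# BalabanUVNodes ∕ N19 — the MGF road at the LIVE selector of record, III: the T-half of the domination, the dressed∕vacuum sandwich of F3's tower at EVERY
# degenerate selector, and ★ THE TOWER IDENTITY — F3's dressed tower at the live re-pin `ppSelLiveOfRecord` IS its dressed tower at `ppSelIdOfRecord`,
# so `MGFForm` at the record (dag-n19-d, identity selector) transfers to the K0′∕K0‴ witness's selector by one rewrite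

Cell `pub-ymgap` (HUMAN RULING D-0062, Track A), node N19 = NE7, R134 seat `pub-ymgap-dag-n19-c` (g6); third module of the LIVE-SELECTOR layer (dag-lead WORDS-132 (2),
DEDUP-248 «n19-c owns `…N19MGFRoadLiveSelector`»; dag-n19-d g6 YIELD-21 ACK l.16005: their MODULE A∕B `…N19MGFKernelTower(MGF)` ∕ `…N19MGFFormAtRecord` state the
IDENTITY-selector case only).  Imports the sibling `…N19MGFRoadLiveSelectorRStep` (hence `…LiveSelector` and dag-n19-e's `…KernelChainRStep`) and K0c's
`Node00/Record12MeasurabilityAnySelector` (`measurable_rstepSlot`; n23-b's `measurable_tstepOfRecord` through it).  Filed `--supports` K3‴ «SpineGivenEndpointR13»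
(stmt-QuantumFields-19912) `--as helper`.  COUNT-NEUTRAL.  THEOREMS ONLY (0 `def`); no Theses import; general `N`; edits nothing; imports NEITHER of dag-n19-d's
modules (the transfer is stated as an EQUALITY OF F3's OBJECTS, so their theorems apply by rewriting, whenever they land).

WHAT IS PROVED ([folklore] ∕ bookkeeping; every object is def-T's ∕ def-R's ∕ F3's, cited by name).
* §7 THE T-HALF `tstepOfRecord_sandwich`: def-T's T-step (†) preserves a pointwise sandwich `m·T₀ ≤ T ≤ M·T₀` (`0 < m`; step weights `0 ≤ w` jointly measurable,
  characters and both slot families measurable, `0 ≤ T₀`): the Bochner integral against the averaging kernel is monotone on integrable data, integrability of the two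
  integrands is EQUIVALENT, and on the non-integrable branch both T-stepped slots take def-T's junk value `0` — NO integrability hypothesis, NO bound on `avgDensity`.
* §8 F3's dressed slots at ANY selector: `dressedStart_sandwich` (`e^{∓|t|}`, `|prodObs| ≤ 1`, `T4DressedR.exp_dressing_bounds`), `measurable_dressedStart`,
  `dressedSlotsOfDatum₉_nonneg` (`0 ≤ w`), `measurable_dressedSlotsOfDatum₉` (measurability provisos DISPLAYED — K0′∕K0‴'s (H-U)∕(H-ζ) rows); ★
  `dressedSlotsOfDatum₉_sandwich_of_moved_not_liveSeq`: at a selector whose moved sequences are, at every level, non-live for F3's VACUUM pre-𝐑 family,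
  `e^{−|t|}·slot⁰_k ≤ slotᵗ_k ≤ e^{|t|}·slot⁰_k` for all `t, k, s, V` (induction: §7 + the sibling's (E)); `…_of_ppSelId` (void hypothesis — dag-n19-d's identity
  induction re-derived from the two halves, for comparison only) and ★ `…_of_ppSelLive` (at the K0′∕K0‴ re-pin, `g 0 = g₀ p.K`): NE1′'s SIZE half for F3's objects
  AT THE SELECTOR OF RECORD, birth constants uniform in the level.
* §9 ★★ THE TOWER IDENTITY.  `rstepSlot_eq_rstepSlot_id_of_moved_not_liveSeq`: at a selector degenerate for a reference family, on a dominated family the R-step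
  of record IS the identity-selector R-step at EVERY sequence (fixed: (B); moved: both sides `0` — the empty∕dead fibre (A), resp. the own ratio of a dead dressed
  term, B16RLeaf's `rratio_eq_zero_of_dead`).  Hence `dressedSlotsOfDatum₉_ppSelLive_eq_ppSelId`: for `ϑ.ppSel = ppSelLiveOfRecord E (wOfRecord₉ ϑ)`, any datum with
  `D.AvgMeasurable`, `g 0 = g₀ p.K`, `0 ≤ w` (jointly measurable), measurable `χ`: **F3's dressed slot family at `ϑ` EQUALS F3's dressed slot family at the identity
  re-pin `{ ϑ with ppSel := ppSelIdOfRecord }`** for every source, level, sequence and field (induction over the pair of sources `(t, 0)`: equal slots ⇒ equal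
  pre-𝐑 families — `wOfRecord₉` does not read the selector — ⇒ §8's domination ⇒ equal R-steps); and `classWeightOfDatum₉_ppSelLive_eq_ppSelId`: the dressed class
  weights — the quantity the MGF road displays `MGFForm` for — are unchanged.  CONSEQUENCE: dag-n19-d's `classWeightOfDatum₉_eq_mgf_of_ppSelId` ∕
  `mgfForm_classWeightOfDatum₉_of_ppSelId` hold AT THE LIVE SELECTOR OF RECORD with the SAME explicit class measures `ν` (their `classMeasureOfDatum₉` at the identity
  re-pin), by one `rw` — no re-key of their measure tower; the corollary is three lines in whichever module imports both (theirs by default: B v1.1).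

HONEST FRAMING.  Order arithmetic, Bochner-integral monotonicity with matched junk values, finite-sum algebra — about def-T's ∕ def-R's ∕ F3's OBJECTS under DISPLAYED
provisos (`D.AvgMeasurable`, `0 ≤ w` jointly measurable, `χ` measurable, `g 0 = g₀ p.K`, the live re-pin); no estimate; nothing of Bałaban's instantiated
([Balaban1989LargeFieldI] (0.3) pp. 176–177, [Balaban1988Convergent] (2.18), (3.1), (3.24), [King1986] (3.10) cited for the SHAPE of the objects only); `MGFForm` itself
is NOT typed here; NE7 ∕ NE1′ NOT proved; N19 NOT discharged (0∕1); K3‴ NOT claimed; counts UNMOVED (typed 28∕28 · discharged 5∕27 · A 5∕28); one finite four-torus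
programme — NOT ℝ⁴, NOT OS, NOT a mass gap, NOT Clay.  0 `def`; 0 `sorry`; standard axioms.
-/

set_option autoImplicit false

noncomputable section

open MeasureTheory
open scoped BigOperators ENNReal

namespace Summit.QuantumFields.YangMills.BalabanUVNodes.N19MGFRoadLiveSelectorTower

open Literature.MathematicalPhysics.QuantumFieldTheory.Balaban1983to89
open Literature.MathematicalPhysics.QuantumFieldTheory.Balaban1983to89.Node00
open Literature.MathematicalPhysics.QuantumFieldTheory.Balaban1983to89.B15.BasicStep (fibreIntegral)
open Literature.MathematicalPhysics.QuantumFieldTheory.Balaban1983to89.B16RLeafRecord12Live (rratio_eq_zero_of_dead)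
open Literature.MathematicalPhysics.QuantumFieldTheory.Balaban1983to89.T4DressedR (exp_dressing_bounds)
open Summit.QuantumFields.YangMills.BalabanUVNodes.N19MGFRoadLiveSelector
open Summit.QuantumFields.YangMills.BalabanUVNodes.N19MGFRoadLiveSelectorRStep
open T4AveragingDisintegration (avgKernel avgDensity)
open T4Continuum

/-! ## §7 The T-half: def-T's T-step (†) preserves a pointwise sandwich (non-negative weights; measurability displayed; the Bochner junk `∫ = 0` matched) -/

section THalf

variable (F : T4Family) (N : ℕ) [NeZero N] (ν : Stage7Numerics) (M : ℕ) {p : B12.RunParams} {g : ℕ → ℝ} {k : ℕ}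

/-- **THE T-STEP (†) PRESERVES A POINTWISE SANDWICH.**  Step weights `0 ≤ w` (jointly measurable), characters `χ_k` (measurable, `≥ 0` always), a reference slot
family `0 ≤ T₀` and a family `T` with `m·T₀ ≤ T ≤ M·T₀` pointwise (`0 < m`), both measurable ⇒ `m·(𝐓 T₀) ≤ 𝐓 T ≤ M·(𝐓 T₀)` pointwise.  The Bochner integral against the
averaging kernel is monotone on integrable data; integrability of the two integrands is EQUIVALENT (`0 < m`), and on the non-integrable branch both T-stepped slots take
def-T's junk value `0` — no integrability hypothesis, no bound on `avgDensity`. [cite: Balaban1988Convergent, (3.1) p.264, (3.24)–(3.25) p.270 (bookkeeping)] -/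
theorem tstepOfRecord_sandwich (w : StepWeightsOfRecord F N ν M) (hw0 : ∀ s' U V', 0 ≤ w p g k s' U V')
    (hwm : ∀ s', Measurable (fun z : GaugeField (F.P p.K) (k + 1) (SU N) × GaugeField (F.P p.K) k (SU N) => w p g k s' z.2 z.1))
    (hχm : ∀ s, Measurable (chiSeqOfRecord F N ν M g p.K k s)) {T₀ T : SeqOfRecord F ν M g p.K k → Density (F.P p.K) k (SU N)}
    (hT₀m : ∀ s, Measurable (T₀ s)) (hTm : ∀ s, Measurable (T s)) (hT₀0 : ∀ s U, 0 ≤ T₀ s U) {m Mc : ℝ} (hm : 0 < m)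
    (hlo : ∀ s U, m * T₀ s U ≤ T s U) (hhi : ∀ s U, T s U ≤ Mc * T₀ s U)
    (s' : SeqOfRecord F ν M g p.K (k + 1)) (V' : GaugeField (F.P p.K) (k + 1) (SU N)) :
    m * tstepOfRecord F N ν M w p g k T₀ s' V' ≤ tstepOfRecord F N ν M w p g k T s' V' ∧
      tstepOfRecord F N ν M w p g k T s' V' ≤ Mc * tstepOfRecord F N ν M w p g k T₀ s' V' := by
  show m * texpASucc _ _ _ _ s' V' ≤ texpASucc _ _ _ _ s' V' ∧ texpASucc _ _ _ _ s' V' ≤ Mc * texpASucc _ _ _ _ s' V'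
  rw [texpASucc_apply, texpASucc_apply]
  set κ := avgKernel (avOfRecord F N p.K k).avg V' with hκ
  set f₀ : GaugeField (F.P p.K) k (SU N) → ℝ := fun U => w p g k s' U V' * (chiSeqOfRecord F N ν M g p.K k s'.init U * T₀ s'.init U) with hf₀
  set f : GaugeField (F.P p.K) k (SU N) → ℝ := fun U => w p g k s' U V' * (chiSeqOfRecord F N ν M g p.K k s'.init U * T s'.init U) with hf
  have h0 : 0 ≤ (avgDensity (avOfRecord F N p.K k).avg V' : ℝ) := NNReal.coe_nonneg _
  have hwsec : Measurable (fun U => w p g k s' U V') := (hwm s').comp measurable_prodMk_left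
  have hf₀m : Measurable f₀ := hwsec.mul ((hχm _).mul (hT₀m _))
  have hfm : Measurable f := hwsec.mul ((hχm _).mul (hTm _))
  have hf₀0 : ∀ U, 0 ≤ f₀ U := fun U =>
    mul_nonneg (hw0 s' U V') (mul_nonneg (chiSeqOfRecord_nonneg F N ν M g p.K k s'.init U) (hT₀0 _ U))
  have hlo' : ∀ U, m * f₀ U ≤ f U := fun U => by
    calc m * f₀ U = w p g k s' U V' * (chiSeqOfRecord F N ν M g p.K k s'.init U * (m * T₀ s'.init U)) := by rw [hf₀]; ring
      _ ≤ f U := mul_le_mul_of_nonneg_left (mul_le_mul_of_nonneg_left (hlo _ U) (chiSeqOfRecord_nonneg F N ν M g p.K k s'.init U)) (hw0 s' U V')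
  have hhi' : ∀ U, f U ≤ Mc * f₀ U := fun U => by
    calc f U ≤ w p g k s' U V' * (chiSeqOfRecord F N ν M g p.K k s'.init U * (Mc * T₀ s'.init U)) :=
          mul_le_mul_of_nonneg_left (mul_le_mul_of_nonneg_left (hhi _ U) (chiSeqOfRecord_nonneg F N ν M g p.K k s'.init U)) (hw0 s' U V')
      _ = Mc * f₀ U := by rw [hf₀]; ring
  have hf0 : ∀ U, 0 ≤ f U := fun U => le_trans (mul_nonneg hm.le (hf₀0 U)) (hlo' U)
  by_cases hint : Integrable f₀ κ
  · have hintf : Integrable f κ :=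
      (hint.const_mul Mc).mono' hfm.aestronglyMeasurable (ae_of_all _ fun U => by
        rw [Real.norm_eq_abs, abs_of_nonneg (hf0 U)]; exact hhi' U)
    have i1 : m * ∫ U, f₀ U ∂κ ≤ ∫ U, f U ∂κ := by
      rw [← integral_const_mul]
      exact integral_mono (hint.const_mul m) hintf hlo'
    have i2 : ∫ U, f U ∂κ ≤ Mc * ∫ U, f₀ U ∂κ := by
      rw [← integral_const_mul]
      exact integral_mono hintf (hint.const_mul Mc) hhi'
    constructor
    · calc m * (↑(avgDensity (avOfRecord F N p.K k).avg V') * ∫ U, f₀ U ∂κ)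
          = ↑(avgDensity (avOfRecord F N p.K k).avg V') * (m * ∫ U, f₀ U ∂κ) := by ring
        _ ≤ _ := mul_le_mul_of_nonneg_left i1 h0
    · calc ↑(avgDensity (avOfRecord F N p.K k).avg V') * ∫ U, f U ∂κ
          ≤ ↑(avgDensity (avOfRecord F N p.K k).avg V') * (Mc * ∫ U, f₀ U ∂κ) := mul_le_mul_of_nonneg_left i2 h0
        _ = _ := by ring
  · -- the junk branch: `f` is not integrable either (else `f₀ ≤ m⁻¹·f` would be), so both T-stepped slots are def-T's `0`
    have hintf : ¬ Integrable f κ := fun hfi => hint <|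
      (hfi.const_mul m⁻¹).mono' hf₀m.aestronglyMeasurable (ae_of_all _ fun U => by
        rw [Real.norm_eq_abs, abs_of_nonneg (hf₀0 U)]
        rw [le_inv_mul_iff₀ hm]
        exact hlo' U)
    rw [integral_undef hint, integral_undef hintf, mul_zero, mul_zero, mul_zero]
    exact ⟨le_rfl, le_rfl⟩

end THalf

/-! ## §8 F3's dressed slots: non-negative and measurable at every level (any selector); the domination induction at a selector DEGENERATE AT EVERY LEVEL -/

section Tower

variable (F : T4Family) (N : ℕ) [NeZero N]

/-- The dressed start `e^{t·F}·e^{−A∕g₀²}` is sandwiched by the vacuum start with `e^{∓|t|}` (`|F| = |prodObs| ≤ 1`, `T4DressedR.exp_dressing_bounds`).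
[cite: King1986, (3.10) p.656 (bookkeeping)] -/
theorem dressedStart_sandwich (D : FiniteEpsData F (SU N)) (g₀ : ℕ → ℝ) (os : List (ULoop F)) (t : ℝ) (p : B12.RunParams)
    (U : GaugeField (F.P p.K) 0 (SU N)) :
    Real.exp (-|t|) * dressedStart F N D g₀ os 0 p U ≤ dressedStart F N D g₀ os t p U ∧
      dressedStart F N D g₀ os t p U ≤ Real.exp |t| * dressedStart F N D g₀ os 0 p U := by
  have hB : ∀ V : GaugeField (F.P p.K) 0 (SU N), |T4GenFunBounds.prodObs (D.scheme g₀) p.K os V| ≤ 1 :=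
    T4GenFunBounds.abs_prodObs_le_one (D.scheme g₀) (fun K o V => D.abs_avgObs_le_one K o V) p.K os
  obtain ⟨hlo, hhi⟩ := exp_dressing_bounds hB t U
  rw [mul_one] at hlo hhi
  have hb : 0 ≤ Missing.boltzmann (F.P p.K) ((g₀ p.K)⁻¹ ^ 2) U := (Missing.boltzmann_pos _ _ U).le
  simp only [dressedStart, zero_mul, Real.exp_zero, one_mul]
  exact ⟨mul_le_mul_of_nonneg_right hlo hb, mul_le_mul_of_nonneg_right hhi hb⟩

/-- The dressed start is measurable when the datum's averaging maps are (`D.AvgMeasurable`; F3's `integrable_dressedStart` ingredients).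
[cite: King1986, (3.10) p.656 (bookkeeping)] -/
theorem measurable_dressedStart (D : FiniteEpsData F (SU N)) (hD : D.AvgMeasurable) (g₀ : ℕ → ℝ) (os : List (ULoop F)) (t : ℝ) (p : B12.RunParams) :
    Measurable (dressedStart F N D g₀ os t p) := by
  have hF : Measurable (T4GenFunBounds.prodObs (D.scheme g₀) p.K os) :=
    T4GenFunBounds.measurable_prodObs (D.scheme g₀) (fun K o => D.measurable_avgObs hD K o) p.K os
  exact (Real.measurable_exp.comp (hF.const_mul t)).mul (Missing.measurable_boltzmann RegularGaugeGroup.measurable_reTr (F.P p.K) _)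

variable (ϑ : Stage9Params F N) (D : FiniteEpsData F (SU N)) (g₀ : ℕ → ℝ) (os : List (ULoop F)) (p : B12.RunParams) (g : ℕ → ℝ)

/-- **F3's dressed slots are NON-NEGATIVE at every level, every source, ANY selector**, given non-negative step weights (dressed start `> 0`; def-T's T-step and
def-R's R-step preserve the sign — n23-b's `tstepOfRecord_nonneg` ∕ `rstepSlot_nonneg`). [cite: Balaban1988Convergent, (2.18) p.257, (3.24) p.270; Balaban1989LargeFieldI, (0.3) p.176 (bookkeeping)] -/
theorem dressedSlotsOfDatum₉_nonneg (hw0 : ∀ k s' U V', 0 ≤ wOfRecord₉ F N ϑ p g k s' U V') (t : ℝ) :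
    ∀ (k : ℕ) (s : SeqOfRecord F ϑ.ν ϑ.τ9.M g p.K k) (V : GaugeField (F.P p.K) k (SU N)), 0 ≤ dressedSlotsOfDatum₉ F N ϑ D g₀ os t p g k s V := by
  intro k
  induction k with
  | zero => intro s V; exact (dressedStart_pos F N D g₀ os t p V).le
  | succ k ih =>
    intro s V
    show 0 ≤ texpAOfRecordFrom F N ϑ.ν ϑ.τ9.M _ _ _ p g (k + 1) s V
    rw [texpAOfRecordFrom_succ]
    exact rstepSlot_nonneg F N ϑ.ν ϑ.τ9 (ϑ.ppSel p g (k + 1)) (tstepOfRecord_nonneg F N ϑ.ν ϑ.τ9.M (hw0 k) ih) s V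

/-- **F3's dressed slots are MEASURABLE at every level, every source, ANY selector**, given `D.AvgMeasurable`, jointly measurable step weights and measurable
characters (n23-b's `measurable_tstepOfRecord`, K0c's `measurable_rstepSlot`).  The measurability provisos are DISPLAYED (they are K0′∕K0‴'s (H-U)∕(H-ζ) rows).
[cite: Balaban1988Convergent, (2.18) p.257, (3.24) p.270; Balaban1989LargeFieldI, (0.3) p.176 (bookkeeping)] -/
theorem measurable_dressedSlotsOfDatum₉ (hD : D.AvgMeasurable)
    (hwm : ∀ k s', Measurable (fun z : GaugeField (F.P p.K) (k + 1) (SU N) × GaugeField (F.P p.K) k (SU N) => wOfRecord₉ F N ϑ p g k s' z.2 z.1))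
    (hχm : ∀ k s, Measurable (chiSeqOfRecord F N ϑ.ν ϑ.τ9.M g p.K k s)) (t : ℝ) :
    ∀ (k : ℕ) (s : SeqOfRecord F ϑ.ν ϑ.τ9.M g p.K k), Measurable (dressedSlotsOfDatum₉ F N ϑ D g₀ os t p g k s) := by
  intro k
  induction k with
  | zero => intro s; exact measurable_dressedStart F N D hD g₀ os t p
  | succ k ih =>
    intro s
    show Measurable (texpAOfRecordFrom F N ϑ.ν ϑ.τ9.M _ _ _ p g (k + 1) s)
    rw [texpAOfRecordFrom_succ]
    exact measurable_rstepSlot F N ϑ.ν ϑ.τ9 (ϑ.ppSel p g (k + 1)) (measurable_tstepOfRecord F N ϑ.ν ϑ.τ9.M (hwm k) ih (hχm k)) (hχm (k + 1)) s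

/-- **THE DRESSED∕VACUUM DOMINATION AT A SELECTOR DEGENERATE AT EVERY LEVEL.**  If at every positive level every sequence MOVED by `ϑ.ppSel p g (k+1)` is non-live for
F3's VACUUM pre-𝐑 family `tstepOfRecord … (dressedSlotsOfDatum₉ … 0 … k)` (void at `ppSelIdOfRecord`; B16RLeaf∕§6 at `ppSelLiveOfRecord`), then for every source `t`,
level `k`, sequence and field: `e^{−|t|}·slot⁰_k ≤ slotᵗ_k ≤ e^{|t|}·slot⁰_k` — birth constants, uniform in the level (`0 ≤ w`, measurability displayed; T-half §7,
R-half (E)). [cite: Balaban1989LargeFieldI, (0.3) p.176; Balaban1988Convergent, (3.24) p.270; King1986, (3.10) p.656 (bookkeeping)] -/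
theorem dressedSlotsOfDatum₉_sandwich_of_moved_not_liveSeq (hD : D.AvgMeasurable) (hw0 : ∀ k s' U V', 0 ≤ wOfRecord₉ F N ϑ p g k s' U V')
    (hwm : ∀ k s', Measurable (fun z : GaugeField (F.P p.K) (k + 1) (SU N) × GaugeField (F.P p.K) k (SU N) => wOfRecord₉ F N ϑ p g k s' z.2 z.1))
    (hχm : ∀ k s, Measurable (chiSeqOfRecord F N ϑ.ν ϑ.τ9.M g p.K k s))
    (hmoved : ∀ k (s : SeqOfRecord F ϑ.ν ϑ.τ9.M g p.K (k + 1)), ϑ.ppSel p g (k + 1) s ≠ s →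
      ¬ LiveSeq F N ϑ.ν ϑ.τ9 p g (k + 1) (tstepOfRecord F N ϑ.ν ϑ.τ9.M (wOfRecord₉ F N ϑ) p g k (dressedSlotsOfDatum₉ F N ϑ D g₀ os 0 p g k)) s)
    (t : ℝ) :
    ∀ (k : ℕ) (s : SeqOfRecord F ϑ.ν ϑ.τ9.M g p.K k) (V : GaugeField (F.P p.K) k (SU N)),
      Real.exp (-|t|) * dressedSlotsOfDatum₉ F N ϑ D g₀ os 0 p g k s V ≤ dressedSlotsOfDatum₉ F N ϑ D g₀ os t p g k s V ∧
        dressedSlotsOfDatum₉ F N ϑ D g₀ os t p g k s V ≤ Real.exp |t| * dressedSlotsOfDatum₉ F N ϑ D g₀ os 0 p g k s V := by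
  intro k
  induction k with
  | zero => intro s V; exact dressedStart_sandwich F N D g₀ os t p V
  | succ k ih =>
    intro s V
    -- T-half on the level-k sandwich, then the R-half (E) at the degenerate selector
    have hpre := tstepOfRecord_sandwich F N ϑ.ν ϑ.τ9.M (wOfRecord₉ F N ϑ) (hw0 k) (hwm k) (hχm k)
      (measurable_dressedSlotsOfDatum₉ F N ϑ D g₀ os p g hD hwm hχm 0 k) (measurable_dressedSlotsOfDatum₉ F N ϑ D g₀ os p g hD hwm hχm t k)
      (dressedSlotsOfDatum₉_nonneg F N ϑ D g₀ os p g hw0 0 k) (Real.exp_pos _) (fun s U => (ih s U).1) (fun s U => (ih s U).2)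
    show Real.exp (-|t|) * texpAOfRecordFrom F N ϑ.ν ϑ.τ9.M _ _ _ p g (k + 1) s V ≤ texpAOfRecordFrom F N ϑ.ν ϑ.τ9.M _ _ _ p g (k + 1) s V ∧
      texpAOfRecordFrom F N ϑ.ν ϑ.τ9.M _ _ _ p g (k + 1) s V ≤ Real.exp |t| * texpAOfRecordFrom F N ϑ.ν ϑ.τ9.M _ _ _ p g (k + 1) s V
    rw [texpAOfRecordFrom_succ, texpAOfRecordFrom_succ]
    exact rstepSlot_sandwich_of_moved_not_liveSeq N F ϑ.ν ϑ.τ9 (ϑ.ppSel p g (k + 1)) _ _ (Real.exp_pos _) (Real.exp_pos _).le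
      (fun a U => (hpre a U).1) (fun a U => (hpre a U).2) (hmoved k) s V

/-- **… AT `ppSelIdOfRecord`** (the hypothesis is void): the dressed∕vacuum domination of F3's tower with birth constants `e^{∓|t|}` — dag-n19-d's identity-selector
induction, re-derived from the two halves for comparison (their MODULE A obtains it from the measure representation). [cite: Balaban1989LargeFieldI, (0.3) p.176 (bookkeeping)] -/
theorem dressedSlotsOfDatum₉_sandwich_of_ppSelId (hid : ∀ k (s : SeqOfRecord F ϑ.ν ϑ.τ9.M g p.K (k + 1)), ϑ.ppSel p g (k + 1) s = s) (hD : D.AvgMeasurable)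
    (hw0 : ∀ k s' U V', 0 ≤ wOfRecord₉ F N ϑ p g k s' U V')
    (hwm : ∀ k s', Measurable (fun z : GaugeField (F.P p.K) (k + 1) (SU N) × GaugeField (F.P p.K) k (SU N) => wOfRecord₉ F N ϑ p g k s' z.2 z.1))
    (hχm : ∀ k s, Measurable (chiSeqOfRecord F N ϑ.ν ϑ.τ9.M g p.K k s)) (t : ℝ) (k : ℕ) (s : SeqOfRecord F ϑ.ν ϑ.τ9.M g p.K k)
    (V : GaugeField (F.P p.K) k (SU N)) :
    Real.exp (-|t|) * dressedSlotsOfDatum₉ F N ϑ D g₀ os 0 p g k s V ≤ dressedSlotsOfDatum₉ F N ϑ D g₀ os t p g k s V ∧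
      dressedSlotsOfDatum₉ F N ϑ D g₀ os t p g k s V ≤ Real.exp |t| * dressedSlotsOfDatum₉ F N ϑ D g₀ os 0 p g k s V :=
  dressedSlotsOfDatum₉_sandwich_of_moved_not_liveSeq F N ϑ D g₀ os p g hD hw0 hwm hχm (fun k s hs => absurd (hid k s) hs) t k s V

/-- **… AT THE LIVE SELECTOR OF RECORD** (`ϑ.ppSel = ppSelLiveOfRecord E (wOfRecord₉ ϑ)`, `g 0 = g₀ p.K`; the hypothesis by §6's `not_liveSeq_vacuum_preR_of_ppSel_ne`):
the dressed∕vacuum domination of F3's tower AT THE K0′∕K0‴ RE-PIN, birth constants `e^{∓|t|}`, uniform in the level — NE1′'s SIZE half for F3's objects at the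
selector of record. [cite: Balaban1989LargeFieldI, (0.3) p.176 and p.177 (bookkeeping)] -/
theorem dressedSlotsOfDatum₉_sandwich_of_ppSelLive (E : B12.RunParams → ℝ) (hsel : ϑ.ppSel = ppSelLiveOfRecord F N ϑ.ν ϑ.τ9 E (wOfRecord₉ F N ϑ))
    (hg : g 0 = g₀ p.K) (hD : D.AvgMeasurable) (hw0 : ∀ k s' U V', 0 ≤ wOfRecord₉ F N ϑ p g k s' U V')
    (hwm : ∀ k s', Measurable (fun z : GaugeField (F.P p.K) (k + 1) (SU N) × GaugeField (F.P p.K) k (SU N) => wOfRecord₉ F N ϑ p g k s' z.2 z.1))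
    (hχm : ∀ k s, Measurable (chiSeqOfRecord F N ϑ.ν ϑ.τ9.M g p.K k s)) (t : ℝ) (k : ℕ) (s : SeqOfRecord F ϑ.ν ϑ.τ9.M g p.K k)
    (V : GaugeField (F.P p.K) k (SU N)) :
    Real.exp (-|t|) * dressedSlotsOfDatum₉ F N ϑ D g₀ os 0 p g k s V ≤ dressedSlotsOfDatum₉ F N ϑ D g₀ os t p g k s V ∧
      dressedSlotsOfDatum₉ F N ϑ D g₀ os t p g k s V ≤ Real.exp |t| * dressedSlotsOfDatum₉ F N ϑ D g₀ os 0 p g k s V :=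
  dressedSlotsOfDatum₉_sandwich_of_moved_not_liveSeq F N ϑ D g₀ os p g hD hw0 hwm hχm
    (fun k _ hs => not_liveSeq_vacuum_preR_of_ppSel_ne F N ϑ E hsel D g₀ os p g hg k hs) t k s V

end Tower

/-! ## §9 ★ THE TOWER IDENTITY: F3's dressed tower AT THE LIVE RE-PIN IS F3's dressed tower AT THE IDENTITY SELECTOR — so everything typed at `ppSelIdOfRecord`
(dag-n19-d's `MGFForm` at the record) transfers to `ppSelLiveOfRecord` by rewriting -/

section TowerIdentity

variable (F : T4Family) (N : ℕ) [NeZero N]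

/-- At a selector degenerate for a reference family `P₀`, on a family `P` it dominates (`0 < m`), **the R-step of record IS the identity-selector R-step** for EVERY
sequence: fixed ones by (B); MOVED ones get `0` from both — the degenerate selector's fibre over a moved `s` contributes nothing (A), and the identity selector
multiplies `P(s)` by the own ratio of a DEAD term (`∫⌈tᴾ_s ≡ 0` by domination of the dead reference term; B16RLeaf's `rratio_eq_zero_of_dead`).
[cite: Balaban1989LargeFieldI, (0.3) p.176 and p.177 (bookkeeping)] -/
theorem rstepSlot_eq_rstepSlot_id_of_moved_not_liveSeq (ν : Stage7Numerics) (τ : TowerNumerics) {p : B12.RunParams} {g : ℕ → ℝ} {k : ℕ}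
    (sel : SeqOfRecord F ν τ.M g p.K k → SeqOfRecord F ν τ.M g p.K k) (P₀ P : TexpASlot F N ν τ.M p g k) {m Mc : ℝ} (hm : 0 < m) (hM : 0 ≤ Mc)
    (hlo : ∀ a U, m * P₀ a U ≤ P a U) (hhi : ∀ a U, P a U ≤ Mc * P₀ a U) (hmoved : ∀ a, sel a ≠ a → ¬ LiveSeq F N ν τ p g k P₀ a)
    (s : SeqOfRecord F ν τ.M g p.K k) (V : GaugeField (F.P p.K) k (SU N)) :
    rstepSlot F N ν τ p g k sel P s V = rstepSlot F N ν τ p g k id P s V := by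
  by_cases hs : sel s = s
  · exact rstepSlot_eq_rstepSlot_id_of_sel_eq N F ν τ sel P₀ P hm hM hlo hhi hmoved hs V
  · rw [rstepSlot_eq_zero_of_sel_ne N F ν τ sel P₀ P hm hM hlo hhi hmoved hs V]
    -- the identity selector also returns `0`: `P(s)·(∫⌈tᴾ_s∕∫⌈tᴾ_s)` with `∫⌈tᴾ_s ≡ 0` (dominated by the dead reference term)
    have hmoved' : ∀ W, rstepSlot F N ν τ p g k id P₀ s W = 0 := fun W => rstepSlot_id_eq_zero_of_not_liveSeq N F ν τ P₀ (hmoved s hs) W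
    symm
    unfold rstepSlot at hmoved' ⊢
    refine (rstepOfSel_id_TexpA N _ (sliceOfRecord F N ν τ.M p g k P) (fibOfSeq F ν τ p g k) s V).trans ?_
    refine mul_eq_zero_of_right _ (rratio_eq_zero_of_dead (sliceOfRecord F N ν τ.M p g k P) (fibOfSeq F ν τ p g k) s ?_ s V)
    intro W
    exact fibreIntegral_rterm_reslot_eq_zero_of_null N _ (sliceOfRecord F N ν τ.M p g k P₀) P (fibOfSeq F ν τ p g k)
      (rterm_reslot_sandwich_of_pointwise _ (sliceOfRecord F N ν τ.M p g k P₀) P (fibOfSeq F ν τ p g k)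
        (fun a W => chiSeqOfRecord_nonneg F N ν τ.M g p.K k a W) hm hM hlo hhi) hmoved' W

variable (ϑ : Stage9Params F N) (D : FiniteEpsData F (SU N)) (g₀ : ℕ → ℝ) (os : List (ULoop F)) (p : B12.RunParams) (g : ℕ → ℝ)

/-- Unfolding of F3's dressed slot at level `k+1` (`texpAOfRecordFrom_succ`): the R-step OF RECORD at `ϑ.ppSel` of the T-step of level `k` — stated for an
ARBITRARY tuple so that a selector re-pin `{ ϑ with ppSel := σ }` rewrites cleanly (`wOfRecord₉`, `ν`, `τ9` do not read the selector). [cite: Balaban1988Convergent, (3.24) p.270; Balaban1989LargeFieldI, (0.3) p.176 (bookkeeping)] -/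
theorem dressedSlotsOfDatum₉_succ_apply (ϑ : Stage9Params F N) (t : ℝ) (k : ℕ) (s : SeqOfRecord F ϑ.ν ϑ.τ9.M g p.K (k + 1))
    (V : GaugeField (F.P p.K) (k + 1) (SU N)) :
    dressedSlotsOfDatum₉ F N ϑ D g₀ os t p g (k + 1) s V
      = rstepSlot F N ϑ.ν ϑ.τ9 p g (k + 1) (ϑ.ppSel p g (k + 1))
          (tstepOfRecord F N ϑ.ν ϑ.τ9.M (wOfRecord₉ F N ϑ) p g k (dressedSlotsOfDatum₉ F N ϑ D g₀ os t p g k)) s V := rfl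

/-- **★ THE TOWER IDENTITY.**  For a Stage-9 tuple `ϑ` PINNED AT THE LIVE SELECTOR OF RECORD (`ϑ.ppSel = ppSelLiveOfRecord E (wOfRecord₉ ϑ)` — K0a's re-pin; e.g. the
Stage-9 part of `theta12LiveOfRecord`), any datum with measurable averaging, `g 0 = g₀ p.K`, non-negative jointly measurable step weights and measurable characters:
F3's DRESSED SLOT FAMILY AT `ϑ` EQUALS F3's DRESSED SLOT FAMILY AT THE IDENTITY RE-PIN `{ ϑ with ppSel := ppSelIdOfRecord }`, for EVERY source `t`, level, sequence and
field.  (Induction: equal slots ⇒ equal pre-𝐑 families — the step weights do not read the selector —; then §8's domination + `rstepSlot_eq_rstepSlot_id_of_moved_not_liveSeq`.)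
Consequence: whatever is typed about F3's tower at `ppSelIdOfRecord` — dag-n19-d's `MGFForm` at the record — holds VERBATIM at the live re-pin.
[cite: Balaban1989LargeFieldI, (0.3) p.176 and p.177; Balaban1988Convergent, (2.18) p.257, (3.24) p.270 (bookkeeping)] -/
theorem dressedSlotsOfDatum₉_ppSelLive_eq_ppSelId (E : B12.RunParams → ℝ) (hsel : ϑ.ppSel = ppSelLiveOfRecord F N ϑ.ν ϑ.τ9 E (wOfRecord₉ F N ϑ))
    (hg : g 0 = g₀ p.K) (hD : D.AvgMeasurable) (hw0 : ∀ k s' U V', 0 ≤ wOfRecord₉ F N ϑ p g k s' U V')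
    (hwm : ∀ k s', Measurable (fun z : GaugeField (F.P p.K) (k + 1) (SU N) × GaugeField (F.P p.K) k (SU N) => wOfRecord₉ F N ϑ p g k s' z.2 z.1))
    (hχm : ∀ k s, Measurable (chiSeqOfRecord F N ϑ.ν ϑ.τ9.M g p.K k s)) (t : ℝ) :
    ∀ (k : ℕ) (s : SeqOfRecord F ϑ.ν ϑ.τ9.M g p.K k) (V : GaugeField (F.P p.K) k (SU N)),
      dressedSlotsOfDatum₉ F N ϑ D g₀ os t p g k s V
        = dressedSlotsOfDatum₉ F N { ϑ with ppSel := ppSelIdOfRecord F ϑ.ν ϑ.τ9.M } D g₀ os t p g k s V := by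
  -- prove it for the pair of sources `(t, 0)` simultaneously (the vacuum towers enter the R-step hypothesis)
  suffices H : ∀ (k : ℕ) (s : SeqOfRecord F ϑ.ν ϑ.τ9.M g p.K k) (V : GaugeField (F.P p.K) k (SU N)),
      dressedSlotsOfDatum₉ F N ϑ D g₀ os t p g k s V
          = dressedSlotsOfDatum₉ F N { ϑ with ppSel := ppSelIdOfRecord F ϑ.ν ϑ.τ9.M } D g₀ os t p g k s V ∧
        dressedSlotsOfDatum₉ F N ϑ D g₀ os 0 p g k s V
          = dressedSlotsOfDatum₉ F N { ϑ with ppSel := ppSelIdOfRecord F ϑ.ν ϑ.τ9.M } D g₀ os 0 p g k s V from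
    fun k s V => (H k s V).1
  intro k
  induction k with
  | zero => intro s V; exact ⟨rfl, rfl⟩
  | succ k ih =>
    intro s V
    -- the pre-𝐑 families at level k+1 coincide (T-step of equal slots; `wOfRecord₉` does not read `ppSel`)
    have hT : ∀ t', (∀ (s : SeqOfRecord F ϑ.ν ϑ.τ9.M g p.K k) (V : GaugeField (F.P p.K) k (SU N)),
        dressedSlotsOfDatum₉ F N ϑ D g₀ os t' p g k s V
          = dressedSlotsOfDatum₉ F N { ϑ with ppSel := ppSelIdOfRecord F ϑ.ν ϑ.τ9.M } D g₀ os t' p g k s V) →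
        tstepOfRecord F N ϑ.ν ϑ.τ9.M (wOfRecord₉ F N ϑ) p g k (dressedSlotsOfDatum₉ F N ϑ D g₀ os t' p g k)
          = tstepOfRecord F N ϑ.ν ϑ.τ9.M (wOfRecord₉ F N ϑ) p g k
              (dressedSlotsOfDatum₉ F N { ϑ with ppSel := ppSelIdOfRecord F ϑ.ν ϑ.τ9.M } D g₀ os t' p g k) := by
      intro t' h
      have hfun : dressedSlotsOfDatum₉ F N ϑ D g₀ os t' p g k
          = dressedSlotsOfDatum₉ F N { ϑ with ppSel := ppSelIdOfRecord F ϑ.ν ϑ.τ9.M } D g₀ os t' p g k := funext fun s => funext fun V => h s V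
      rw [hfun]
    have hTt := hT t (fun s V => (ih s V).1)
    have hT0 := hT 0 (fun s V => (ih s V).2)
    -- the level-(k+1) pre-𝐑 sandwich at `ϑ` (T-half on §8's level-k domination at the live selector)
    have hsw := dressedSlotsOfDatum₉_sandwich_of_ppSelLive F N ϑ D g₀ os p g E hsel hg hD hw0 hwm hχm
    have hpre : ∀ t', ∀ (a : SeqOfRecord F ϑ.ν ϑ.τ9.M g p.K (k + 1)) (U : GaugeField (F.P p.K) (k + 1) (SU N)),
        Real.exp (-|t'|) * tstepOfRecord F N ϑ.ν ϑ.τ9.M (wOfRecord₉ F N ϑ) p g k (dressedSlotsOfDatum₉ F N ϑ D g₀ os 0 p g k) a U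
            ≤ tstepOfRecord F N ϑ.ν ϑ.τ9.M (wOfRecord₉ F N ϑ) p g k (dressedSlotsOfDatum₉ F N ϑ D g₀ os t' p g k) a U ∧
          tstepOfRecord F N ϑ.ν ϑ.τ9.M (wOfRecord₉ F N ϑ) p g k (dressedSlotsOfDatum₉ F N ϑ D g₀ os t' p g k) a U
            ≤ Real.exp |t'| * tstepOfRecord F N ϑ.ν ϑ.τ9.M (wOfRecord₉ F N ϑ) p g k (dressedSlotsOfDatum₉ F N ϑ D g₀ os 0 p g k) a U :=
      fun t' => tstepOfRecord_sandwich F N ϑ.ν ϑ.τ9.M (wOfRecord₉ F N ϑ) (hw0 k) (hwm k) (hχm k)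
        (measurable_dressedSlotsOfDatum₉ F N ϑ D g₀ os p g hD hwm hχm 0 k) (measurable_dressedSlotsOfDatum₉ F N ϑ D g₀ os p g hD hwm hχm t' k)
        (dressedSlotsOfDatum₉_nonneg F N ϑ D g₀ os p g hw0 0 k) (Real.exp_pos _) (fun a U => (hsw t' k a U).1) (fun a U => (hsw t' k a U).2)
    have hmoved : ∀ a : SeqOfRecord F ϑ.ν ϑ.τ9.M g p.K (k + 1), ϑ.ppSel p g (k + 1) a ≠ a →
        ¬ LiveSeq F N ϑ.ν ϑ.τ9 p g (k + 1) (tstepOfRecord F N ϑ.ν ϑ.τ9.M (wOfRecord₉ F N ϑ) p g k (dressedSlotsOfDatum₉ F N ϑ D g₀ os 0 p g k)) a :=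
      fun a ha => not_liveSeq_vacuum_preR_of_ppSel_ne F N ϑ E hsel D g₀ os p g hg k ha
    -- the R-step of record at `ϑ.ppSel` IS the identity-selector R-step (fixed: (B); moved: both `0`); the identity re-pin's R-step is `id`'s by `rfl`
    have step : ∀ t', tstepOfRecord F N ϑ.ν ϑ.τ9.M (wOfRecord₉ F N ϑ) p g k (dressedSlotsOfDatum₉ F N ϑ D g₀ os t' p g k)
          = tstepOfRecord F N ϑ.ν ϑ.τ9.M (wOfRecord₉ F N ϑ) p g k
              (dressedSlotsOfDatum₉ F N { ϑ with ppSel := ppSelIdOfRecord F ϑ.ν ϑ.τ9.M } D g₀ os t' p g k) →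
        dressedSlotsOfDatum₉ F N ϑ D g₀ os t' p g (k + 1) s V
          = dressedSlotsOfDatum₉ F N { ϑ with ppSel := ppSelIdOfRecord F ϑ.ν ϑ.τ9.M } D g₀ os t' p g (k + 1) s V := by
      intro t' hTeq
      rw [dressedSlotsOfDatum₉_succ_apply, dressedSlotsOfDatum₉_succ_apply]
      show rstepSlot F N ϑ.ν ϑ.τ9 p g (k + 1) (ϑ.ppSel p g (k + 1)) _ s V
        = rstepSlot F N ϑ.ν ϑ.τ9 p g (k + 1) (fun a => a)
            (tstepOfRecord F N ϑ.ν ϑ.τ9.M (wOfRecord₉ F N ϑ) p g k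
              (dressedSlotsOfDatum₉ F N { ϑ with ppSel := ppSelIdOfRecord F ϑ.ν ϑ.τ9.M } D g₀ os t' p g k)) s V
      rw [← hTeq]
      exact rstepSlot_eq_rstepSlot_id_of_moved_not_liveSeq F N ϑ.ν ϑ.τ9 (ϑ.ppSel p g (k + 1)) _ _ (Real.exp_pos _) (Real.exp_pos _).le
        (fun a U => (hpre t' a U).1) (fun a U => (hpre t' a U).2) hmoved s V
    exact ⟨step t hTt, step 0 hT0⟩

/-- **★ … HENCE THE DRESSED CLASS WEIGHTS AT THE LIVE RE-PIN ARE THE IDENTITY RE-PIN's**: `classWeightOfDatum₉ ϑ D g₀ os p g k t s` (F3's run-A term weight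
`∫ χ_k(s)·slotᵗ_k(s) dV_k`, the quantity the MGF road displays `MGFForm` for) is UNCHANGED by re-pinning the selector from `ppSelLiveOfRecord` to `ppSelIdOfRecord` —
so dag-n19-d's `classWeightOfDatum₉_eq_mgf_of_ppSelId` ∕ `mgfForm_classWeightOfDatum₉_of_ppSelId` (at-record MODULE B) hold AT THE K0′∕K0‴ WITNESS's LIVE SELECTOR by
ONE rewrite, with the same explicit class measures `ν`. [cite: Balaban1988Convergent, (2.18) p.257; King1986, (3.10) p.656 (bookkeeping)] -/
theorem classWeightOfDatum₉_ppSelLive_eq_ppSelId (E : B12.RunParams → ℝ) (hsel : ϑ.ppSel = ppSelLiveOfRecord F N ϑ.ν ϑ.τ9 E (wOfRecord₉ F N ϑ))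
    (hg : g 0 = g₀ p.K) (hD : D.AvgMeasurable) (hw0 : ∀ k s' U V', 0 ≤ wOfRecord₉ F N ϑ p g k s' U V')
    (hwm : ∀ k s', Measurable (fun z : GaugeField (F.P p.K) (k + 1) (SU N) × GaugeField (F.P p.K) k (SU N) => wOfRecord₉ F N ϑ p g k s' z.2 z.1))
    (hχm : ∀ k s, Measurable (chiSeqOfRecord F N ϑ.ν ϑ.τ9.M g p.K k s)) (k : ℕ) (t : ℝ) (s : SeqOfRecord F ϑ.ν ϑ.τ9.M g p.K k) :
    classWeightOfDatum₉ F N ϑ D g₀ os p g k t s = classWeightOfDatum₉ F N { ϑ with ppSel := ppSelIdOfRecord F ϑ.ν ϑ.τ9.M } D g₀ os p g k t s := by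
  unfold classWeightOfDatum₉
  refine integral_congr_ae (ae_of_all _ fun V => ?_)
  show chiSeqOfRecord F N ϑ.ν ϑ.τ9.M g p.K k s V * dressedSlotsOfDatum₉ F N ϑ D g₀ os t p g k s V
    = chiSeqOfRecord F N ϑ.ν ϑ.τ9.M g p.K k s V * dressedSlotsOfDatum₉ F N { ϑ with ppSel := ppSelIdOfRecord F ϑ.ν ϑ.τ9.M } D g₀ os t p g k s V
  rw [dressedSlotsOfDatum₉_ppSelLive_eq_ppSelId F N ϑ D g₀ os p g E hsel hg hD hw0 hwm hχm t k s V]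

end TowerIdentity

end Summit.QuantumFields.YangMills.BalabanUVNodes.N19MGFRoadLiveSelectorTower

end
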